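import Summits.Ventures.PackingBounds.Configurations.DesignSlackness
import Summits.Ventures.PackingBounds.Energy.ChebyshevUExplicit
import Mathlib.Analysis.InnerProductSpace.PiL2

/-!
# The Cohn–Conway–Elkies–Kumar / Sali family of 24-point spherical 5-designs on `S³` (rotated hexagons of `D₄`)

Framing: lottery ticket; floor = certified bounds/negative ranges. Venture `PackingBounds` (cell
`pub-packcert`, seat `pub-packcert-energy`) — companion of `D4NotUniversallyOptimal.lean`.

Cohn–Conway–Elkies–Kumar (Exp. Math. 16 (2007), §4; after Sali 1994, Lemma 2.3) fix an Eisenstein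
structure `ℝ⁴ = ℂ²` and split the `24` roots of `D₄` into four regular hexagons
`H_0 = {(w,0)}, H_1 = {(uiw, tiw)}, H_2 = {(uiw, r tiw)}, H_3 = {(uiw, r̄ tiw)}` (`w ∈ μ₆`, `u = √(1/3)`,
`t = √(2/3)`, `r = e^{2πi/3}`), and show that for all unit complex numbers `a_0, …, a_3` the rotated union
`D(a_0,a_1,a_2,a_3) = ⋃ a_m H_m` is a **spherical 5-design** of `24` points on `S³` — a three-parameter family
of deformations of `D₄ = D(1,1,1,1)`. This file proves it in the tree's design vocabulary (vanishing total
Gegenbauer moments `Σ_{x,y} C_k^{(1)}(⟨x,y⟩) = 0`, `k = 1,…,5`, `C_k^{(1)} = U_k`): `design5`, with per-point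
moments (`pointMoment_eq_zero`), cardinality `24` (`card_config`) and unit norms (`norm_of_mem_config`); and the
consequence used in CCEK §5, that every member has the `D₄` root system's `(1+t)^k`-energy for `k ≤ 5`
(`ckPow_energy_eq`). Mechanism (= the paper's "each rotated hexagon is a 5-design in its plane"): writing the
points as `ρ_j(σ_m h_m)` with `ρ_j` = multiplication by `e^{ijπ/3}` and `σ_m` by `a_m` (real isometries of
`ℝ⁴` commuting with each other), the inner products inside a block `(m, m')` are `cos6_d X + sin6_d Y`
(`d = j' - j`, `(X, Y)` = the invariant pair `(⟨σ_m h_m, σ_{m'} h_{m'}⟩, ω(σ_m h_m, σ_{m'} h_{m'}))` with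
`X² + Y² ∈ {1, 1/3}` independent of the phases), and the six-fold sums `Σ_d U_k(cos6_d X + sin6_d Y)`, `k ≤ 5`, are
polynomials in `X² + Y²` alone (`sixfold_sum`).

## References
* H. Cohn, J. H. Conway, N. D. Elkies, A. Kumar, *The D₄ root system is not universally optimal*,
  Experiment. Math. 16 (2007) 313–320, §4. [`CohnConwayElkiesKumar2007`]
* A. Sali, *On the rigidity of spherical t-designs that are orbits of finite reflection groups*,
  Des. Codes Cryptogr. 4 (1994) 157–170, Lemma 2.3.
-/

noncomputable section

namespace Summit.Ventures.PackingBounds.Config.HexagonDesigns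

open Finset Literature.Analysis.SpecialFunctions Summit.Ventures.PackingBounds.Energy

/-! ### Surds -/

/-- `(√3)² = 3`. -/
private theorem s3sq : Real.sqrt 3 ^ 2 = 3 := Real.sq_sqrt (by norm_num)

/-- `(√2)² = 2`. -/
private theorem s2sq : Real.sqrt 2 ^ 2 = 2 := Real.sq_sqrt (by norm_num)

/-- `√6 = √2 √3`. -/
private theorem s6eq : Real.sqrt 6 = Real.sqrt 2 * Real.sqrt 3 := by
  rw [← Real.sqrt_mul (by norm_num : (0 : ℝ) ≤ 2)]; norm_num

/-! ### The scalar rotation action of `S¹` on `ℝ⁴ = ℂ²` and the invariant symplectic pairing -/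

/-- Multiplication by the unit complex number `c + is` on both coordinates of `ℂ² = ℝ⁴`. -/
def rot (c s : ℝ) (x : EuclideanSpace ℝ (Fin 4)) : EuclideanSpace ℝ (Fin 4) :=
  WithLp.toLp 2 ![c * x 0 - s * x 1, s * x 0 + c * x 1, c * x 2 - s * x 3, s * x 2 + c * x 3]

/-- The pairing `ω(x, y) = -Im⟨x, y⟩_ℂ` on `ℂ² = ℝ⁴`. -/
def bform (x y : EuclideanSpace ℝ (Fin 4)) : ℝ := x 1 * y 0 - x 0 * y 1 + x 3 * y 2 - x 2 * y 3

/-- Coordinates of `rot`. -/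
@[simp] theorem rot_apply_zero (c s : ℝ) (x : EuclideanSpace ℝ (Fin 4)) : rot c s x 0 = c * x 0 - s * x 1 := rfl
/-- Coordinates of `rot`. -/
@[simp] theorem rot_apply_one (c s : ℝ) (x : EuclideanSpace ℝ (Fin 4)) : rot c s x 1 = s * x 0 + c * x 1 := rfl
/-- Coordinates of `rot`. -/
@[simp] theorem rot_apply_two (c s : ℝ) (x : EuclideanSpace ℝ (Fin 4)) : rot c s x 2 = c * x 2 - s * x 3 := rfl
/-- Coordinates of `rot`. -/
@[simp] theorem rot_apply_three (c s : ℝ) (x : EuclideanSpace ℝ (Fin 4)) : rot c s x 3 = s * x 2 + c * x 3 := rfl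

/-- The inner product of `ℝ⁴` in coordinates. [folklore] -/
theorem inner_four (x y : EuclideanSpace ℝ (Fin 4)) :
    inner ℝ x y = x 0 * y 0 + x 1 * y 1 + x 2 * y 2 + x 3 * y 3 := by
  simp [PiLp.inner_apply, Fin.sum_univ_four, mul_comm]

/-- **Inner products after rotating both arguments**: `⟨ρ x, ρ' y⟩ = cos(φ-φ') ⟨x,y⟩ - sin(φ-φ') ω(x,y)`. -/
theorem inner_rot_rot (c s c' s' : ℝ) (x y : EuclideanSpace ℝ (Fin 4)) :
    inner ℝ (rot c s x) (rot c' s' y) =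
      (c * c' + s * s') * inner ℝ x y - (s * c' - c * s') * bform x y := by
  rw [inner_four, inner_four]
  simp only [rot_apply_zero, rot_apply_one, rot_apply_two, rot_apply_three, bform]
  ring

/-- **The pairing after rotating both arguments**: `ω(ρ x, ρ' y) = sin(φ-φ') ⟨x,y⟩ + cos(φ-φ') ω(x,y)`. -/
theorem bform_rot_rot (c s c' s' : ℝ) (x y : EuclideanSpace ℝ (Fin 4)) :
    bform (rot c s x) (rot c' s' y) =
      (s * c' - c * s') * inner ℝ x y + (c * c' + s * s') * bform x y := by
  rw [inner_four]
  simp only [rot_apply_zero, rot_apply_one, rot_apply_two, rot_apply_three, bform]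
  ring

/-- `ω` is alternating. -/
theorem bform_self (x : EuclideanSpace ℝ (Fin 4)) : bform x x = 0 := by
  simp only [bform]; ring

/-! ### The sixth roots of unity -/

/-- `cos(jπ/3)`, `j = 0..5`. -/
def cos6 (j : ℕ) : ℝ :=
  match j with | 0 => 1 | 1 => 1 / 2 | 2 => -1 / 2 | 3 => -1 | 4 => -1 / 2 | 5 => 1 / 2 | _ => 1

/-- `sin(jπ/3)`, `j = 0..5`. -/
def sin6 (j : ℕ) : ℝ :=
  match j with
  | 0 => 0 | 1 => Real.sqrt 3 / 2 | 2 => Real.sqrt 3 / 2 | 3 => 0 | 4 => -(Real.sqrt 3 / 2)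
  | 5 => -(Real.sqrt 3 / 2) | _ => 0

/-- Angle addition on `μ₆`, cosine part: `cos(jπ/3)cos((j+d)π/3) + sin(jπ/3)sin((j+d)π/3) = cos(dπ/3)`. -/
theorem cos6_add (j d : Fin 6) :
    cos6 j.val * cos6 (j + d).val + sin6 j.val * sin6 (j + d).val = cos6 d.val := by
  have h3 := s3sq
  fin_cases j <;> fin_cases d <;> simp [cos6, sin6] <;> nlinarith [h3]

/-- Angle addition on `μ₆`, sine part: `sin(jπ/3)cos((j+d)π/3) - cos(jπ/3)sin((j+d)π/3) = -sin(dπ/3)`. -/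
theorem sin6_add (j d : Fin 6) :
    sin6 j.val * cos6 (j + d).val - cos6 j.val * sin6 (j + d).val = -sin6 d.val := by
  have h3 := s3sq
  fin_cases j <;> fin_cases d <;> simp [cos6, sin6] <;> nlinarith [h3]

/-- **Six-fold sum of `U_1`** vanishes: `Σ_{d<6} U_1(cos(dπ/3) X + sin(dπ/3) Y) = 0`. -/
theorem sixfold_sum_one (X Y : ℝ) :
    ∑ d : Fin 6, gegenbauerSum 1 1 (cos6 d.val * X + sin6 d.val * Y) = 0 := by
  simp only [Fin.sum_univ_six, ChebyshevU.c1_1, cos6, sin6]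
  norm_num; ring

/-- **Six-fold sum of `U_2`** sees only `X² + Y²`: `= 12(X²+Y²) - 6`. -/
theorem sixfold_sum_two (X Y : ℝ) :
    ∑ d : Fin 6, gegenbauerSum 1 2 (cos6 d.val * X + sin6 d.val * Y) = 12 * (X ^ 2 + Y ^ 2) - 6 := by
  have h3 := s3sq
  simp only [Fin.sum_univ_six, ChebyshevU.c1_2, cos6, sin6]
  norm_num
  linear_combination ((4 : ℝ) * Y ^ 2) * h3

/-- **Six-fold sum of `U_3`** vanishes. -/
theorem sixfold_sum_three (X Y : ℝ) :
    ∑ d : Fin 6, gegenbauerSum 1 3 (cos6 d.val * X + sin6 d.val * Y) = 0 := by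
  simp only [Fin.sum_univ_six, ChebyshevU.c1_3, cos6, sin6]
  norm_num; ring

/-- **Six-fold sum of `U_4`** sees only `X² + Y²`: `= 36(X²+Y²)² - 36(X²+Y²) + 6`. -/
theorem sixfold_sum_four (X Y : ℝ) :
    ∑ d : Fin 6, gegenbauerSum 1 4 (cos6 d.val * X + sin6 d.val * Y) =
      36 * (X ^ 2 + Y ^ 2) ^ 2 - 36 * (X ^ 2 + Y ^ 2) + 6 := by
  have h3 := s3sq
  simp only [Fin.sum_univ_six, ChebyshevU.c1_4, cos6, sin6]
  norm_num
  linear_combination ((-12 : ℝ) * Y ^ 2 + (12 : ℝ) * Y ^ 4 + (4 : ℝ) * Y ^ 4 * Real.sqrt 3 ^ 2 +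
    (24 : ℝ) * X ^ 2 * Y ^ 2) * h3

/-- **Six-fold sum of `U_5`** vanishes. -/
theorem sixfold_sum_five (X Y : ℝ) :
    ∑ d : Fin 6, gegenbauerSum 1 5 (cos6 d.val * X + sin6 d.val * Y) = 0 := by
  simp only [Fin.sum_univ_six, ChebyshevU.c1_5, cos6, sin6]
  norm_num; ring

/-- `cos² + sin² = 1` on `μ₆`. -/
theorem cos6_sq_add_sin6_sq (d : Fin 6) : cos6 d.val ^ 2 + sin6 d.val ^ 2 = 1 := by
  have h3 := s3sq
  fin_cases d <;> simp [cos6, sin6] <;> nlinarith [h3]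

/-! ### The four hexagon planes -/

/-- Base vectors `h_0 = (1, 0)`, `h_1 = (ui, ti)`, `h_2 = (ui, r ti)`, `h_3 = (ui, r̄ ti)` of `ℂ²` (`u = √(1/3)`,
`t = √(2/3)`, `r = e^{2πi/3}`; CCEK §4) in real coordinates `(Re z₁, Im z₁, Re z₂, Im z₂)`:
`(1,0,0,0)`, `(0, √3/3, 0, √6/3)`, `(0, √3/3, -√2/2, -√6/6)`, `(0, √3/3, √2/2, -√6/6)`.
[cite: CohnConwayElkiesKumar2007, §4 (the hexagons H_0, …, H_3)] -/
def hvec (m : ℕ) : EuclideanSpace ℝ (Fin 4) :=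
  match m with
  | 0 => WithLp.toLp 2 ![1, 0, 0, 0]
  | 1 => WithLp.toLp 2 ![0, Real.sqrt 3 / 3, 0, Real.sqrt 6 / 3]
  | 2 => WithLp.toLp 2 ![0, Real.sqrt 3 / 3, -(Real.sqrt 2 / 2), -(Real.sqrt 6 / 6)]
  | _ => WithLp.toLp 2 ![0, Real.sqrt 3 / 3, Real.sqrt 2 / 2, -(Real.sqrt 6 / 6)]

/-- Gram table of the base vectors: an orthonormal (real) basis of `ℝ⁴`. -/
theorem inner_hvec (m m' : Fin 4) :
    inner ℝ (hvec m.val) (hvec m'.val) = if m = m' then 1 else 0 := by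
  have h2 := s2sq; have h3 := s3sq
  have h22 : Real.sqrt 2 ^ 4 = 4 := by nlinarith [h2]
  have h23 : Real.sqrt 2 ^ 2 * Real.sqrt 3 ^ 2 = 6 := by rw [h2, h3]; norm_num
  have h223 : Real.sqrt 2 ^ 4 * Real.sqrt 3 ^ 2 = 12 := by rw [h22, h3]; norm_num
  fin_cases m <;> fin_cases m' <;> rw [inner_four] <;> simp [hvec, s6eq] <;> ring_nf <;>
    linarith [h2, h3, h22, h23, h223]

/-- Pairing table of the base vectors: `ω(h_m, h_{m'})² = 1/3` off the diagonal (the hexagon planes are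
distinct complex lines making the angle `|⟨h_m, h_{m'}⟩_ℂ| = 1/√3`), `0` on it. -/
theorem bform_hvec_sq (m m' : Fin 4) :
    bform (hvec m.val) (hvec m'.val) ^ 2 = if m = m' then 0 else 1 / 3 := by
  have h2 := s2sq; have h3 := s3sq
  have h22 : Real.sqrt 2 ^ 4 = 4 := by nlinarith [h2]
  have h23 : Real.sqrt 2 ^ 2 * Real.sqrt 3 ^ 2 = 6 := by rw [h2, h3]; norm_num
  have h223 : Real.sqrt 2 ^ 4 * Real.sqrt 3 ^ 2 = 12 := by rw [h22, h3]; norm_num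
  fin_cases m <;> fin_cases m' <;> simp only [bform] <;> simp [hvec, s6eq] <;> ring_nf <;>
    linarith [h2, h3, h22, h23, h223]

/-! ### The configurations `D(a_0, a_1, a_2, a_3)` -/

/-- Point `(m, j)` of `D(a)`: `e^{ijπ/3} · (a_m · h_m)` with phases `a_m = c m + i s m`. -/
def pt (c s : Fin 4 → ℝ) (a : Fin 4 × Fin 6) : EuclideanSpace ℝ (Fin 4) :=
  rot (cos6 a.2.val) (sin6 a.2.val) (rot (c a.1) (s a.1) (hvec a.1.val))

/-- The configuration `D(a) = ⋃_m a_m H_m` (rotated hexagons; `a = (1,1,1,1)` is the `D₄` root system).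
[cite: CohnConwayElkiesKumar2007, §4 (definition of D(a_0,a_1,a_2,a_3))] -/
def config (c s : Fin 4 → ℝ) : Finset (EuclideanSpace ℝ (Fin 4)) :=
  univ.image (pt c s)

section family

variable {c s : Fin 4 → ℝ} (hcs : ∀ m, c m ^ 2 + s m ^ 2 = 1)

/-- Block inner products: `⟨pt(m,j), pt(m',j+d)⟩ = cos(dπ/3) X_{mm'} + sin(dπ/3) Y_{mm'}` with the block
invariants `X = ⟨a_m h_m, a_{m'} h_{m'}⟩`, `Y = ω(a_m h_m, a_{m'} h_{m'})`. -/
theorem inner_pt_add (c s : Fin 4 → ℝ) (m m' : Fin 4) (j d : Fin 6) :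
    inner ℝ (pt c s (m, j)) (pt c s (m', j + d)) =
      cos6 d.val * inner ℝ (rot (c m) (s m) (hvec m.val)) (rot (c m') (s m') (hvec m'.val)) +
        sin6 d.val * bform (rot (c m) (s m) (hvec m.val)) (rot (c m') (s m') (hvec m'.val)) := by
  simp only [pt]
  rw [inner_rot_rot, cos6_add j d, sin6_add j d]
  ring

include hcs

/-- The block invariant `X² + Y²` does not see the phases: `1` on the diagonal, `1/3` off it. -/
theorem block_sq_add_sq (m m' : Fin 4) :
    inner ℝ (rot (c m) (s m) (hvec m.val)) (rot (c m') (s m') (hvec m'.val)) ^ 2 +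
      bform (rot (c m) (s m) (hvec m.val)) (rot (c m') (s m') (hvec m'.val)) ^ 2 =
        if m = m' then 1 else 1 / 3 := by
  rw [inner_rot_rot, bform_rot_rot]
  have hA := inner_hvec m m'
  have hB := bform_hvec_sq m m'
  have hφ : (c m * c m' + s m * s m') ^ 2 + (s m * c m' - c m * s m') ^ 2 = 1 := by
    have := hcs m; have := hcs m'; nlinarith
  have key : ∀ (α β A B : ℝ), ((α * A - β * B) ^ 2 + (β * A + α * B) ^ 2) =
      (α ^ 2 + β ^ 2) * (A ^ 2 + B ^ 2) := fun α β A B => by ring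
  rw [key, hφ, one_mul]
  split_ifs at hA hB ⊢ with h
  · rw [hA, hB]; norm_num
  · rw [hA, hB]; norm_num

/-- Diagonal block invariant: `X_{mm} = 1`. -/
theorem block_inner_self (m : Fin 4) :
    inner ℝ (rot (c m) (s m) (hvec m.val)) (rot (c m) (s m) (hvec m.val)) = 1 := by
  rw [inner_rot_rot, inner_hvec, bform_self, if_pos rfl]
  have := hcs m
  nlinarith

omit hcs in
/-- Diagonal block invariant: `Y_{mm} = 0`. -/
theorem block_bform_self (m : Fin 4) :
    bform (rot (c m) (s m) (hvec m.val)) (rot (c m) (s m) (hvec m.val)) = 0 := bform_self _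

/-- Every point of `D(a)` is a unit vector. -/
theorem norm_pt (a : Fin 4 × Fin 6) : ‖pt c s a‖ = 1 := by
  obtain ⟨m, j⟩ := a
  have h : inner ℝ (pt c s (m, j)) (pt c s (m, j + 0)) = 1 := by
    rw [inner_pt_add, block_inner_self hcs, block_bform_self]; simp [cos6, sin6]
  rw [add_zero, real_inner_self_eq_norm_sq] at h
  nlinarith [norm_nonneg (pt c s (m, j))]

/-- The `24` points of `D(a)` are pairwise distinct. -/
theorem pt_injective : Function.Injective (pt c s) := by
  rintro ⟨m, j⟩ ⟨m', j'⟩ h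
  obtain ⟨d, rfl⟩ : ∃ d, j' = j + d := ⟨j' - j, by abel⟩
  have h1 : inner ℝ (pt c s (m, j)) (pt c s (m', j + d)) = 1 := by
    rw [h, real_inner_self_eq_norm_sq, norm_pt hcs]; norm_num
  rw [inner_pt_add] at h1
  by_cases hm : m = m'
  · subst hm
    rw [block_inner_self hcs, block_bform_self] at h1
    have h3 := s3sq
    fin_cases d <;> simp [cos6, sin6] at h1 ⊢ <;> nlinarith [h1, h3]
  · exfalso
    have hXY := block_sq_add_sq hcs m m'
    rw [if_neg hm] at hXY
    have hz := cos6_sq_add_sin6_sq d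
    nlinarith [sq_nonneg (cos6 d.val * bform (rot (c m) (s m) (hvec m.val)) (rot (c m') (s m') (hvec m'.val)) -
      sin6 d.val * inner ℝ (rot (c m) (s m) (hvec m.val)) (rot (c m') (s m') (hvec m'.val)))]

/-- **`D(a)` has `24` points.** -/
theorem card_config : (config c s).card = 24 := by
  rw [config, card_image_of_injective _ (pt_injective hcs)]
  simp

/-- **Every point of `D(a)` is a unit vector.** -/
theorem norm_of_mem_config : ∀ x ∈ config c s, ‖x‖ = 1 := by
  intro x hx
  obtain ⟨a, _, rfl⟩ := mem_image.1 hx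
  exact norm_pt hcs a

omit hcs in
/-- Block sums: for each block `(m, m')` and each `j`, the sum over the partner hexagon of
`U_k(⟨pt(m,j), pt(m',j')⟩)` is the six-fold sum at the block invariants. -/
theorem block_sum (k : ℕ) (m m' : Fin 4) (j : Fin 6) :
    ∑ j' : Fin 6, gegenbauerSum 1 k (inner ℝ (pt c s (m, j)) (pt c s (m', j'))) =
      ∑ d : Fin 6, gegenbauerSum 1 k
        (cos6 d.val * inner ℝ (rot (c m) (s m) (hvec m.val)) (rot (c m') (s m') (hvec m'.val)) +
          sin6 d.val * bform (rot (c m) (s m) (hvec m.val)) (rot (c m') (s m') (hvec m'.val))) := by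
  rw [← Equiv.sum_comp (Equiv.addLeft j)]
  simp only [Equiv.coe_addLeft, inner_pt_add]

/-- **The indexed design identity**: `Σ_{a,b} U_k(⟨pt a, pt b⟩) = 0` for `k = 1, …, 5`. -/
theorem moment_pt_eq_zero (k : ℕ) (hk1 : 1 ≤ k) (hk5 : k ≤ 5) :
    ∑ a : Fin 4 × Fin 6, ∑ b : Fin 4 × Fin 6, gegenbauerSum 1 k (inner ℝ (pt c s a) (pt c s b)) = 0 := by
  simp_rw [Fintype.sum_prod_type, block_sum]
  interval_cases k
  · simp [sixfold_sum_one]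
  · simp_rw [sixfold_sum_two, block_sq_add_sq hcs]
    simp [Fin.sum_univ_four]
    norm_num
  · simp [sixfold_sum_three]
  · simp_rw [sixfold_sum_four, block_sq_add_sq hcs]
    simp [Fin.sum_univ_four]
    norm_num
  · simp [sixfold_sum_five]

/-- **`D(a_0, a_1, a_2, a_3)` is a spherical 5-design** (Cohn–Conway–Elkies–Kumar 2007, §4; Sali): for all
phases and every `k = 1, …, 5` the total Gegenbauer moment `Σ_{x, y ∈ D(a)} C_k^{(1)}(⟨x,y⟩)` vanishes
(`C_k^{(1)} = U_k`, the zonal polynomials of `S³`). [cite: CohnConwayElkiesKumar2007, §4 (D(a_0,…,a_3) is a 5-design)] -/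
theorem design5 (k : ℕ) (hk1 : 1 ≤ k) (hk5 : k ≤ 5) :
    ∑ x ∈ config c s, ∑ y ∈ config c s, gegenbauerSum 1 k (inner ℝ x y) = 0 := by
  rw [config, sum_image fun a _ b _ h => pt_injective hcs h]
  simp_rw [sum_image fun a _ b _ h => pt_injective hcs h]
  exact moment_pt_eq_zero hcs k hk1 hk5

/-- **Per-point moments**: around every point `x ∈ D(a)`, `Σ_{y ∈ D(a)} U_k(⟨x,y⟩) = 0` for `k = 1, …, 5`
(positive semidefiniteness of the Gegenbauer matrix, `DesignSlackness`). -/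
theorem pointMoment_eq_zero (k : ℕ) (hk1 : 1 ≤ k) (hk5 : k ≤ 5) {x : EuclideanSpace ℝ (Fin 4)}
    (hx : x ∈ config c s) : ∑ y ∈ config c s, gegenbauerSum 1 k (inner ℝ x y) = 0 :=
  DesignSlackness.pointMoment_eq_zero_of_total (n := 4) (μ := 1) (by norm_num) (by norm_num)
    (config c s) (norm_of_mem_config hcs) k (design5 hcs k hk1 hk5) hx

end family

end Summit.Ventures.PackingBounds.Config.HexagonDesigns

end
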